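import Summits.SmoothPoincare4.SmoothPoincare4.Theorems.ContractibleTwistedDoubleStandard.Negative.ContactGluing

/-!
# `ContractibleTwistedDoubleStandard` — negative-side support: the seam map is a contactomorphism (linear-algebra half)

Support lemma for the crux
`Summit.SmoothPoincare4.SmoothPoincare4.Theses.ConvexBisection.ContractibleTwistedDoubleStandard`
(stmt-SmoothPoincare4-3546), from the standing disprover's work file
`Cruxes/ContractibleTwistedDoubleStandard/Disproof.lean` (cycle 2, §2):

* `mem_contactPlane_iff_of_matching` — the converse of the matching part of
  `Negative.steinBisection_of_contactGluing`: GIVEN the seam map `ψ` as a diffeomorphism of abstract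
  boundaries intertwining the two embeddings (`e₂ ∘ incl₂ ∘ ψ = e₁ ∘ incl₁`) and injectivity of
  `de₁`, `de₂` at boundary points, the crux's matching of pushed-forward complex tangencies makes `ψ`
  a contactomorphism in the differential sense (`d(incl₂ ∘ ψ)_z v ∈ ξ₂ ↔ d(incl₁)_z v ∈ ξ₁`, the
  lines' `IsContacto`, written out).  Pure linear algebra (chain rule + cancellation of the injective
  `deᵢ`); it isolates, for the prover of the lines' `stub_seam`, the two genuinely geometric inputs:
  smoothness of `ψ` and injectivity of the differential of an immersion at BOUNDARY points of a
  `𝓡∂ 4`-manifold (the tree's `mfderiv_injective_of_isImmersionAt` wants a boundaryless source).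
-/

noncomputable section

open scoped Manifold ContDiff Topology
open Set Function Literature.Geometry.Symplectic Literature.Topology.FourManifolds

namespace Summit.SmoothPoincare4.SmoothPoincare4.Theorems.ContractibleTwistedDoubleStandard.Negative

variable {W₁ : Type*} [TopologicalSpace W₁] [ChartedSpace (EuclideanHalfSpace 4) W₁]
  [IsManifold (𝓡∂ 4) ∞ W₁] [CompactSpace W₁]
  {W₂ : Type*} [TopologicalSpace W₂] [ChartedSpace (EuclideanHalfSpace 4) W₂]
  [IsManifold (𝓡∂ 4) ∞ W₂] [CompactSpace W₂]

/-- **The matching clause makes the seam map a contactomorphism.**  If `e₁ : W₁ → X`, `e₂ : W₂ → X`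
are smooth, `ψ` is a diffeomorphism of abstract boundaries with `e₂ ∘ incl₂ ∘ ψ = e₁ ∘ incl₁`,
`de₁` and `de₂` are injective at boundary points, and the pushed-forward complex tangencies agree at
common points (the crux's clause), then `d(incl₂ ∘ ψ)_z v ∈ ξ₂ ↔ d(incl₁)_z v ∈ ξ₁` for all `z, v`.
Proof: `de₁ (d incl₁ v) = de₂ (d(incl₂ ∘ ψ) v)` by the chain rule; transport membership along the
matching equation and cancel the injective differential. [folklore] -/
theorem mem_contactPlane_iff_of_matching {X : Type*} [TopologicalSpace X]
    [ChartedSpace (EuclideanSpace ℝ (Fin 4)) X]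
    (S₁ : SteinStructure W₁) (S₂ : SteinStructure W₂)
    (b₁ : BoundaryData (𝓡∂ 4) W₁ (𝓡 3)) (b₂ : BoundaryData (𝓡∂ 4) W₂ (𝓡 3))
    {e₁ : W₁ → X} {e₂ : W₂ → X}
    (he₁ : ContMDiff (𝓡∂ 4) (𝓡 4) ∞ e₁) (he₂ : ContMDiff (𝓡∂ 4) (𝓡 4) ∞ e₂)
    (hinj₁ : ∀ z : b₁.carrier, Injective (mfderiv (𝓡∂ 4) (𝓡 4) e₁ (b₁.incl z)))
    (hinj₂ : ∀ y : b₂.carrier, Injective (mfderiv (𝓡∂ 4) (𝓡 4) e₂ (b₂.incl y)))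
    (hC : ∀ w₁ w₂, e₁ w₁ = e₂ w₂ →
      Submodule.map (mfderiv (𝓡∂ 4) (𝓡 4) e₁ w₁).toLinearMap (contactPlane S₁.J w₁) =
        Submodule.map (mfderiv (𝓡∂ 4) (𝓡 4) e₂ w₂).toLinearMap (contactPlane S₂.J w₂))
    (ψ : b₁.carrier ≃ₘ⟮𝓡 3, 𝓡 3⟯ b₂.carrier) (hψ : ∀ z, e₂ (b₂.incl (ψ z)) = e₁ (b₁.incl z))
    (z : b₁.carrier) (v : EuclideanSpace ℝ (Fin 3)) :
    mfderiv (𝓡 3) (𝓡∂ 4) (b₂.incl ∘ ψ) z v ∈ contactPlane S₂.J (b₂.incl (ψ z)) ↔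
      mfderiv (𝓡 3) (𝓡∂ 4) b₁.incl z v ∈ contactPlane S₁.J (b₁.incl z) := by
  have hcomp : e₁ ∘ b₁.incl = e₂ ∘ (b₂.incl ∘ ψ) := funext fun z => (hψ z).symm
  have hi₁ : MDifferentiableAt (𝓡 3) (𝓡∂ 4) b₁.incl z :=
    b₁.isSmoothEmbedding.contMDiff.mdifferentiableAt (by simp)
  have hi₂ : MDifferentiableAt (𝓡 3) (𝓡∂ 4) (b₂.incl ∘ ψ) z :=
    (b₂.isSmoothEmbedding.contMDiff.comp ψ.contMDiff).mdifferentiableAt (by simp)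
  have hjA : MDifferentiableAt (𝓡∂ 4) (𝓡 4) e₁ (b₁.incl z) := he₁.mdifferentiableAt (by simp)
  have hjB : MDifferentiableAt (𝓡∂ 4) (𝓡 4) e₂ ((b₂.incl ∘ ψ) z) := he₂.mdifferentiableAt (by simp)
  have chain : mfderiv (𝓡∂ 4) (𝓡 4) e₁ (b₁.incl z) (mfderiv (𝓡 3) (𝓡∂ 4) b₁.incl z v) =
      mfderiv (𝓡∂ 4) (𝓡 4) e₂ (b₂.incl (ψ z)) (mfderiv (𝓡 3) (𝓡∂ 4) (b₂.incl ∘ ψ) z v) := by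
    rw [← mfderiv_comp_apply z hjA hi₁ v, hcomp]
    exact mfderiv_comp_apply z hjB hi₂ v
  have hm := hC (b₁.incl z) (b₂.incl (ψ z)) (hψ z).symm
  constructor
  · intro h2
    -- membership transported along `hm`; destructured by `whnf` (`Submodule.mem_map` is `Iff.rfl`)
    have hmem := (SetLike.ext_iff.mp hm _).mpr (Submodule.mem_map.2 ⟨_, h2, rfl⟩)
    obtain ⟨u, hu, hu'⟩ := hmem
    have : u = mfderiv (𝓡 3) (𝓡∂ 4) b₁.incl z v := hinj₁ z (hu'.trans chain.symm)
    rwa [this] at hu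
  · intro h1
    have hmem := (SetLike.ext_iff.mp hm _).mp (Submodule.mem_map.2 ⟨_, h1, rfl⟩)
    obtain ⟨w, hw, hw'⟩ := hmem
    have : w = mfderiv (𝓡 3) (𝓡∂ 4) (b₂.incl ∘ ψ) z v := hinj₂ (ψ z) (hw'.trans chain)
    rwa [this] at hw

end Summit.SmoothPoincare4.SmoothPoincare4.Theorems.ContractibleTwistedDoubleStandard.Negative
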